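import Mathlib
import HarnessLib
import Summits.NavierStokesRegularity.NavierStokesRegularity.Theorems.TaylorModelRungThreeVRadiiDefs

/-!
# Line `taylor-model` on crux K1b-DR (stmt-NavierStokesRegularity-23954) — v3 (VECTOR STEP) semantic interface, part 3:
# `ReadoutData`, `InStepKer`, `kiter`, `ReadoutsV`, `ValidV`   [tm-g4 g3 = VDefs / ReadoutsV pen; director rulings
# dss_63 (2) / dss_65 (▶F4 face-wise landing), PROPAGATE-V-SPEC-cert1 rev. bcee1edc §1 «TUBE», §3 (Λ), §4 (landing);
# cert-1 09:51Z: single outer hull H² = H¹ ⊕ ΛT·κ·ω tolerable, window M-bounds over B ⊕ BK fine]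

Definitions-only module (no theorems, no sorry), companion of `…VDefs` (`StepBoxes`, `ChainVCore`, `IsFlowPackageV`)
and `…VRadiiDefs` (`RadiiData`, `NodePair`, `DerivEncl`, `ChainVRadii`).  It hosts the READ-OUT clauses of the v3
certificate — everything the G-side ports (G2-v crossing, G3-v κ-tube / segment derivatives, G4-v landing C¹) read
besides the chain:

* `InStepKer cd bx j s u A` — the real kernel `A` obeys, entrywise, the in-step column Taylor model of sub-step `(j,s)`
  at time `u` at SOME point of the outer hull (the shape of the conclusions of (F8″) `inStep_meanValue_of_core` and
  (F9) `exists_fderiv_directional_of_core`; the checker bounds it by its interval variational jets over H²);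
* `kiter cd A s₀ n v` — `n`-fold action of a kernel chain `A s₀, A (s₀+1), …` on a state (node-to-node transport of a
  deviation / of a direction by mean-value or derivative kernels, each in `[Mlo, Mhi]` by (F8′)/(F9)+(M));
* `ReadoutData` — per stage: the in-step boxes `ylo/yhi l j` (`l = 0`: centre set, `l = 1`: polytope set) over the
  LAST sub-step, the derivative kernel interval `[Vlo j, Vhi j]` (∋ kernel of `D_q φ(q)(Tn_{S−1}+u) ∘ Dsc j`, every `u`
  of the last sub-step, every polytope `q`), the tube-growth table `G j s₀ s₁` and the hull inflation multiple `ΛT j`;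
* `ReadoutsV cd bx rd ro` — per stage `j ≤ N₀` (with `S := cd.S j`): (R0) `Tn S ≤ τs`, base point in the polytope,
  `0 < γ`, `0 ≤ ΛT`, `σf` reads the window only (`σf y = σf (trunc y)`); (R1) TUBE HULL `H¹_s ⊕ ΛT·κ·ω ⊆ H²_s` at every node; (R2) TUBE GROWTH: every chain of real kernels
  `A s' ∈ [Mlo s', Mhi s']`, `s₀ ≤ s' < s₁`, maps the `r·ω`-ball into the `G s₀ s₁·r·ω`-ball; (R3) `L1·G ≤ ΛT`,
  `L1·G·L1 ≤ Λ`, `L1 ≤ Λ` (K1b-DR's Λ from forward factors only); (R4) window M-bounds per sub-step (`B ⊕ BK ⊆ [−M, M]`,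
  `B ⊆ ±(M − Λδτs·ω − mm)`); (R5) section before node `S−1` / after node `S` on the level-1 hulls; (R6) in-step boxes:
  `TP(u) + r + A·(y − x_{S−1}) ∈ [ylo l, yhi l]` for `y ∈ H^l_{S−1}`, `|r| ≤ J·u^(p+1)`, `A` in-step kernel; (R7)
  transversality `γ ≤ σf(Qb y y)` on `Y¹`; (R8) crossing read-outs (`as`, behind-shell) on `Y¹ ∩ {σf = lev}`; (R9) base
  landing inequality with allowance `β` on `Y⁰ ∩ {σf = lev}`; (R10) the derivative kernel over the last sub-step,
  `A(u)·(Vc + Cm·W) ∈ [Vlo, Vhi]` for in-step kernels `A(u)` and `W ∈ [Z_{S−1}]`; (R11) LANDING DERIVATIVE BOUND: for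
  `y ∈ Y¹ ∩ {σf = lev}`, `V ∈ [Vlo, Vhi]`, `q = x j 0 + Dsc ζ` in the polytope and admissible tails `v`,
  `|ℓ_{nx j,l} (landD y v (P_y (V ζ)))| ≤ β j l` with the section correction `P_y z = z − (σf z / σf (Qb y y))·Qb y y`
  (▶F4: discharged face-wise on the K-side from `Δ = A − Js` and the level matrices — that algebra is the checker's,
  the clause here is its semantic content);
* `ValidV cd bx rd ro := cd.Static ∧ cd.StageNumerics ∧ ChainV cd bx rd ∧ ReadoutsV cd bx rd ro` — the v3 certificate
  predicate the closer targets (`∃ cd bx rd ro, ValidV …` replaces `∃ cd, cd.Valid`).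

MODEL-lattice rung TL-M3 only; nothing here is a statement about the Navier–Stokes equations, and nothing is asserted.
-/

noncomputable section

-- the sub-problem namespace repeats the summit name by design (D-0017)
set_option linter.dupNamespace false

namespace Summit.NavierStokesRegularity.NavierStokesRegularity.Theorems.TaylorModelV

open Set Literature.Analysis.FluidPDE.TaoCascade Literature.Analysis.FluidPDE.TaoCascade.TaylorChain
open Summit.NavierStokesRegularity.NavierStokesRegularity.Theorems.TaylorModelReadout

/-- **In-step kernel** of sub-step `(j,s)` at time `u`: every window entry of the real kernel `A` is within
`JU·ω_col⁻¹·u^(pdegV+1)` of the variational Taylor polynomial `Σ_{n≤pdegV} varJet cd.Qb ζ (basisSt i k) n · u^n` at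
SOME point `ζ` of the outer hull `[hlo 2, hhi 2]` (row by row, column by column — the shape (F8″)/(F9) deliver).
[folklore] -/
def InStepKer (cd : CertData) (bx : StepBoxes) (j s : ℕ) (u : ℝ) (A : Ker) : Prop :=
  ∀ i' k', -cd.Kb ≤ k' → k' ≤ cd.Ka → ∀ i k, -cd.Kb ≤ k → k ≤ cd.Ka →
    ∃ ζ : Fin 4 → ℤ → ℝ, InBox cd (bx.hlo 2 j s) (bx.hhi 2 j s) ζ ∧
      |A i' k' i k - ∑ n ∈ Finset.range (bx.pdegV + 1), varJet cd.Qb ζ (basisSt i k) n i' k' * u ^ n|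
        ≤ bx.JU j s i' k' * (cd.ω j k)⁻¹ * u ^ (bx.pdegV + 1)

/-- **Iterated kernel action**: `kiter cd A s₀ n v = A (s₀+n−1) · ( ⋯ (A s₀ · v))` through `kapp`. [folklore] -/
def kiter (cd : CertData) (A : ℕ → Ker) (s₀ : ℕ) : ℕ → (Fin 4 → ℤ → ℝ) → (Fin 4 → ℤ → ℝ)
  | 0, v => v
  | n + 1, v => kapp cd (A (s₀ + n)) (kiter cd A s₀ n v)

/-- Admissible tail vectors of the landing map (K1b-DR's `|v i| ≤ √(10·Cg·2^(−7(Ka+1)))`). [folklore] -/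
def TailOK (cd : CertData) (v : Fin 4 → ℝ) : Prop :=
  ∀ i, |v i| ≤ Real.sqrt (10 * cd.Cg * (2:ℝ) ^ (-(7:ℝ) * ((cd.Ka:ℝ) + 1)))

/-- The section correction of a direction `z` at a crossing state `y`: `z − (σf z / σf (Qb y y)) • Qb y y` (the
derivative of the crossing state along a family of trajectories is the section-corrected flow derivative). [folklore] -/
def secCorr (cd : CertData) (j : ℕ) (y z : Fin 4 → ℤ → ℝ) : Fin 4 → ℤ → ℝ :=
  z - (cd.σf j z / cd.σf j (cd.Qb y y)) • cd.Qb y y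

/-- **Read-out record** of the v3 certificate (per stage `j`; all functions junk-valued beyond the indices used):
in-step boxes `ylo/yhi l j` over the last sub-step for the centre set (`l = 0`) and the polytope set (`l = 1`);
derivative kernel interval `[Vlo j, Vhi j]`; tube-growth table `G j s₀ s₁`; hull inflation multiple `ΛT j`.
[folklore] -/
structure ReadoutData where
  (ylo yhi : Fin 2 → ℕ → (Fin 4 → ℤ → ℝ))
  (Vlo Vhi : ℕ → Ker)
  G : ℕ → ℕ → ℕ → ℝ
  ΛT : ℕ → ℝ

/-- Level index of `StepBoxes` hulls (`Fin 3`) from the read-out level (`Fin 2`). [folklore] -/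
def hullLevel (l : Fin 2) : Fin 3 := ⟨l.1, l.2.trans (by norm_num)⟩

/-- **(TM-V read-outs)** — see the module docstring for the clause list (R0)–(R11). [folklore] -/
def ReadoutsV (cd : CertData) (bx : StepBoxes) (rd : RadiiData) (ro : ReadoutData) : Prop :=
  ∀ j, j ≤ cd.N₀ →
    -- (R0) stage scalars, the base point, and the section functional reads the window only
    cd.Tn j (cd.S j) ≤ cd.τs ∧ InPoly cd j (cd.x j 0) ∧ 0 < cd.γ j ∧ 0 ≤ ro.ΛT j ∧
    (∀ y : Fin 4 → ℤ → ℝ, cd.σf j y = cd.σf j (trunc cd y)) ∧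
    -- (R1) TUBE HULL: the level-1 hull inflated by `ΛT·κ·ω` lies in the outer hull, at every node
    (∀ s', s' ≤ cd.S j → ∀ y d : Fin 4 → ℤ → ℝ, InBox cd (bx.hlo 1 j s') (bx.hhi 1 j s') y →
      cd.InBall j d (ro.ΛT j * cd.κ j) → InBox cd (bx.hlo 2 j s') (bx.hhi 2 j s') (y + d)) ∧
    -- (R2) TUBE GROWTH over every chain of real one-step kernels
    (∀ s₀ s₁, s₀ ≤ s₁ → s₁ ≤ cd.S j → ∀ A : ℕ → Ker,
      (∀ s', s₀ ≤ s' → s' < s₁ → KerMem cd (A s') (bx.Mlo j s') (bx.Mhi j s')) →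
      ∀ (v : Fin 4 → ℤ → ℝ) (r : ℝ), 0 ≤ r → cd.InBall j v r →
        cd.InBall j (kiter cd A s₀ (s₁ - s₀) v) (ro.G j s₀ s₁ * r)) ∧
    -- (R3) K1b-DR's `Λ` and the hull multiple `ΛT` from the forward factors `L1` and `G`
    (∀ a b, a < cd.S j → a + 1 ≤ b → b ≤ cd.S j →
      cd.L1 j a * ro.G j (a + 1) b ≤ ro.ΛT j ∧ (b < cd.S j → cd.L1 j a * ro.G j (a + 1) b * cd.L1 j b ≤ cd.Λ j)) ∧
    (∀ a, a < cd.S j → cd.L1 j a ≤ cd.Λ j) ∧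
    -- (R4) window M-bounds per sub-step
    (∀ s', s' < cd.S j → ∀ i k, -cd.Kb ≤ k → k ≤ cd.Ka →
      -cd.M k ≤ bx.lo j s' i k + bx.loK j s' i k ∧ bx.hi j s' i k + bx.hiK j s' i k ≤ cd.M k ∧
      -(cd.M k - cd.Λ j * cd.δ j * cd.τs * cd.ω j k - cd.mm) ≤ bx.lo j s' i k ∧
      bx.hi j s' i k ≤ cd.M k - cd.Λ j * cd.δ j * cd.τs * cd.ω j k - cd.mm) ∧
    -- (R5) section: before at node `S−1`, after at node `S` (level-1 hulls)
    (∀ y, InBox cd (bx.hlo 1 j (cd.S j - 1)) (bx.hhi 1 j (cd.S j - 1)) y → cd.σf j y < cd.lev j) ∧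
    (∀ y, InBox cd (bx.hlo 1 j (cd.S j)) (bx.hhi 1 j (cd.S j)) y → cd.lev j < cd.σf j y) ∧
    -- (R6) in-step boxes over the last sub-step (levels 0 and 1)
    (∀ l : Fin 2, ∀ u ∈ Icc 0 (cd.h j (cd.S j - 1)), ∀ A : Ker, InStepKer cd bx j (cd.S j - 1) u A →
      ∀ y, InBox cd (bx.hlo (hullLevel l) j (cd.S j - 1)) (bx.hhi (hullLevel l) j (cd.S j - 1)) y →
      ∀ r : Fin 4 → ℤ → ℝ, AbsLeW cd r (fun i k => bx.J j (cd.S j - 1) i k * u ^ (cd.pdeg + 1)) →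
        InBox cd (ro.ylo l j) (ro.yhi l j) (cd.TP j (cd.S j - 1) u + r + kapp cd A (y - cd.x j (cd.S j - 1)))) ∧
    -- (R7) transversality on the level-1 in-step box
    (∀ y, InBox cd (ro.ylo 1 j) (ro.yhi 1 j) y → cd.γ j ≤ cd.σf j (cd.Qb y y)) ∧
    -- (R8) crossing read-outs on `Y¹ ∩ {σf = lev}`
    (∀ y, InBox cd (ro.ylo 1 j) (ro.yhi 1 j) y → cd.σf j y = cd.lev j →
      cd.as j ≤ |y cd.i₀ 1| ∧
      ∀ i, |y i (-cd.Kb)| + cd.Λ j * cd.δ j * cd.τs * cd.ω j (-cd.Kb) ≤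
        (2:ℝ) ^ (-cd.θ) * (cd.Cb * (2:ℝ) ^ ((3:ℝ) / 4 * ((cd.Kb:ℝ) + 1)))) ∧
    -- (R9) base landing on `Y⁰ ∩ {σf = lev}`
    (∀ y, InBox cd (ro.ylo 0 j) (ro.yhi 0 j) y → cd.σf j y = cd.lev j → ∀ v, TailOK cd v → ∀ l,
      |cd.ℓ (cd.nx j) l (cd.land j y v) - cd.ctr (cd.nx j) l| + cd.β j l ≤ cd.rad (cd.nx j) l - cd.s (cd.nx j) l) ∧
    -- (R10) derivative kernel over the last sub-step: in-step kernel ∘ (Vc + Cm·[Z]) ∈ [Vlo, Vhi]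
    (∀ u ∈ Icc 0 (cd.h j (cd.S j - 1)), ∀ A : Ker, InStepKer cd bx j (cd.S j - 1) u A →
      ∀ W : Ker, KerMem cd W (rd.Zlo j (cd.S j - 1)) (rd.Zhi j (cd.S j - 1)) →
        KerMem cd (kerOf fun v => kapp cd A (rd.Vc j (cd.S j - 1) v + cd.Cm j (cd.S j - 1) (kapp cd W v)))
          (ro.Vlo j) (ro.Vhi j)) ∧
    -- (R11) landing derivative bound (face-wise on the K-side)
    (∀ y, InBox cd (ro.ylo 1 j) (ro.yhi 1 j) y → cd.σf j y = cd.lev j →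
      ∀ V : Ker, KerMem cd V (ro.Vlo j) (ro.Vhi j) →
      ∀ q ζ : Fin 4 → ℤ → ℝ, InPoly cd j q → (∀ i k, -cd.Kb ≤ k → k ≤ cd.Ka → q i k = (cd.x j 0 + rd.Dsc j ζ) i k) →
      ∀ v, TailOK cd v → ∀ l,
        |cd.ℓ (cd.nx j) l (cd.landD j y v (secCorr cd j y (kapp cd V ζ)))| ≤ cd.β j l)

/-- **The v3 certificate predicate**: statics and stage numerics (unchanged Literature predicates), the vector-step
chain `ChainV = ChainVCore ∧ ChainVRadii`, and the read-outs. [folklore] -/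
def ValidV (cd : CertData) (bx : StepBoxes) (rd : RadiiData) (ro : ReadoutData) : Prop :=
  cd.Static ∧ cd.StageNumerics ∧ ChainV cd bx rd ∧ ReadoutsV cd bx rd ro

end Summit.NavierStokesRegularity.NavierStokesRegularity.Theorems.TaylorModelV

end
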